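import Literature.Computability.Complexity.BrickAlgebra
import Literature.Computability.Complexity.FoldBricks
import Literature.Computability.Complexity.FPStringBricks
import Literature.Computability.Complexity.NSubexp
import HarnessLib

/-!
# The integer square root of a binary numeral is in `FP`

Toolkit (`Computability/Complexity`, brick algebra of `BrickAlgebra.lean`, `StackBricks*.lean`,
`FoldBricks.lean`, `FPStringBricks.lean`, `NSubexp.lean`): the total string function
`w ↦ bin ⌊√⟦w⟧⌋` — the integer square root of the VALUE of a binary numeral (least significant
bit first, read by the total `bitsToNat`) — is in `FP` (`Brick.natSqrt_mem_FP`). (The sibling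
`IsqrtBrick.lean` takes the square root of the LENGTH of its input, i.e. of a unary numeral, by
linear search; for an `L`-bit numeral that search would need `2^{L/2}` rounds.) Here the root is
found by the schoolbook digit-by-digit method: `L + 1` rounds of the counted loop `loopFn_mem_FP`
on the record `⟨w, ⟨counter, bin t⟩⟩`, the round with counter `k + 1` replacing `t` by `t + 2ᵏ`
when `(t + 2ᵏ)² ≤ ⟦w⟧` (the power `2ᵏ` is recomputed from the counter through the ruler `w`, so a
round never outgrows the input, whatever the record holds); the invariant `t² ≤ ⟦w⟧ < (t + 2ᵏ)²`
ends in `t = ⌊√⟦w⟧⌋` (`Nat.eq_sqrt`). Stated directly as membership of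
`fun w => encodeNat (Nat.sqrt (bitsToNat w))` in `FP`, so that no new definition is introduced.

Used by `Cryptography/PolyTimeComputableRealsSqrt.lean` (polynomial-time computable reals are
closed under square roots: `⌊2ⁿ√x⌋` from `⌊√(4ⁿ x)⌋`).

## References

* S. Arora, B. Barak, *Computational Complexity: A Modern Approach*, CUP 2009, §1.3 (polynomial
  time is closed under composition and bounded loops) [AroraBarakCC2009].
* D. E. Knuth, *The Art of Computer Programming*, Vol. 2, 3rd ed., 1998, §4.3.1 (classical
  multiple-precision algorithms). (Schoolbook; fully proved here.)
-/

namespace Literature.Computability.Complexity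

open _root_.Computability Polynomial TimeConstructible

namespace Brick

/-- The schoolbook square-root scan is correct: from `t² ≤ N < (t + 2ᵏ)²`, deciding the bits
`k - 1, …, 0` of the root greedily ends at `⌊√N⌋`. Phrased for an arbitrary model `F` of the loop
(`F k t` = the state reached from state `t` by the rounds with counters `k, …, 1`), required to
follow the scan for `k < K` only. [folklore] -/
theorem sqrtScan_eq_sqrt {N K : ℕ} (F : ℕ → ℕ → ℕ) (h0 : ∀ t, F 0 t = t)
    (hs : ∀ k t, k < K → F (k + 1) t = F k (if (t + 2 ^ k) * (t + 2 ^ k) ≤ N then t + 2 ^ k else t)) :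
    ∀ (k t : ℕ), k ≤ K → t * t ≤ N → N < (t + 2 ^ k) * (t + 2 ^ k) → F k t = Nat.sqrt N := by
  intro k
  induction k with
  | zero =>
    intro t _ h1 h2
    rw [h0]
    rw [pow_zero] at h2
    exact Nat.eq_sqrt.2 ⟨h1, h2⟩
  | succ k ih =>
    intro t hk h1 h2
    rw [hs k t (by omega)]
    split_ifs with h
    · refine ih _ (by omega) h ?_
      have : t + 2 ^ k + 2 ^ k = t + 2 ^ (k + 1) := by rw [pow_succ]; ring
      rw [this]
      exact h2
    · exact ih _ (by omega) h1 (not_le.1 h)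

/-- `bin 2ᵏ` has `k + 1` symbols. [folklore] -/
theorem length_encodeNat_two_pow (k : ℕ) : (encodeNat (2 ^ k)).length = k + 1 := by
  rw [TM2Pass.length_encodeNat_eq_size, Nat.size_pow]

/-- The power-of-two brick of the square-root round: on any string `z`,
`powFn 1 (binToUnaryFn ⟨fstF z, predCntF z⟩) = bin 2^{min (⟦counter⟧ - 1) |fstF z|}` — the power is
capped by the ruler `fstF z`. [folklore] -/
theorem powFn_binToUnaryFn_apply (z : List Bool) :
    (powFn 1 ∘ binToUnaryFn ∘ fanoutFn (nthF 0) predCntF) z =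
      encodeNat (2 ^ min (bitsToNat (predCntF z)) (fstF z).length) := by
  simp only [Function.comp_apply, fanoutFn_apply, nthF_zero, binToUnaryFn_boolPair]
  rw [show ones (min (bitsToNat (predCntF z)) (fstF z).length) =
      unaryEncodeNat (min (bitsToNat (predCntF z)) (fstF z).length) from
    (OracleCompose.unaryEncodeNat_eq_replicate _).symm, powFn_unary, pow_one]

/-- **`w ↦ bin ⌊√⟦w⟧⌋` is in `FP`** (integer square root of the value of a binary numeral, by the
digit-by-digit method as a counted loop of `|w| + 1` rounds). [cite: AroraBarakCC2009, §1.3] -/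
theorem natSqrt_mem_FP : (fun w => encodeNat (Nat.sqrt (bitsToNat w))) ∈ FP := by
  -- the candidate `u = t + 2ᵏ` (state `t = ⟦sndPow 1 z⟧`, `k = ⟦counter⟧ - 1` capped by `|fstF z|`)
  set U : List Bool → List Bool :=
    addFn ∘ fanoutFn (sndPow 1) (powFn 1 ∘ binToUnaryFn ∘ fanoutFn (nthF 0) predCntF) with hU
  -- the loop body: `u` if `u² ≤ ⟦x⟧`, else (the normal form of) `t`
  set body : List Bool → List Bool :=
    iteFn (notFn (ltFn ∘ fanoutFn (nthF 0) (prodFn ∘ fanoutFn U U))) U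
      (addFn ∘ fanoutFn (sndPow 1) (fun _ => [])) with hbody
  have hUmem : U ∈ FP := by
    rw [hU]
    exact comp_mem_FP addFn_mem_FP (fanoutFn_mem_FP (sndPow_mem_FP 1)
      (comp_mem_FP (powFn_mem_FP 1) (comp_mem_FP binToUnaryFn_mem_FP
        (fanoutFn_mem_FP (nthF_mem_FP 0) predCntF_mem_FP))))
  have hbodymem : body ∈ FP := by
    rw [hbody]
    exact iteFn_mem_FP (notFn_mem_FP (comp_mem_FP ltFn_mem_FP (fanoutFn_mem_FP (nthF_mem_FP 0)
      (comp_mem_FP prodFn_mem_FP (fanoutFn_mem_FP hUmem hUmem))))) hUmem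
      (comp_mem_FP addFn_mem_FP (fanoutFn_mem_FP (sndPow_mem_FP 1) (const_mem_FP _)))
  -- value of `U` on every string
  have hUapply : ∀ z, U z = encodeNat (bitsToNat (sndPow 1 z) +
      2 ^ min (bitsToNat (predCntF z)) (fstF z).length) := by
    intro z
    rw [hU, Function.comp_apply, fanoutFn_apply, powFn_binToUnaryFn_apply, addFn_boolPair, bitsToNat_encodeNat]
  -- value of the body on every string
  have hbapply : ∀ z, body z =
      if (bitsToNat (sndPow 1 z) + 2 ^ min (bitsToNat (predCntF z)) (fstF z).length) *
          (bitsToNat (sndPow 1 z) + 2 ^ min (bitsToNat (predCntF z)) (fstF z).length) ≤ bitsToNat (fstF z) then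
        encodeNat (bitsToNat (sndPow 1 z) + 2 ^ min (bitsToNat (predCntF z)) (fstF z).length)
      else encodeNat (bitsToNat (sndPow 1 z)) := by
    intro z
    have htest : (notFn (ltFn ∘ fanoutFn (nthF 0) (prodFn ∘ fanoutFn U U))) z =
        [!decide (bitsToNat (fstF z) <
          (bitsToNat (sndPow 1 z) + 2 ^ min (bitsToNat (predCntF z)) (fstF z).length) *
          (bitsToNat (sndPow 1 z) + 2 ^ min (bitsToNat (predCntF z)) (fstF z).length))] := by
      refine notFn_apply ?_
      simp only [Function.comp_apply, fanoutFn_apply, nthF_zero, prodFn_boolPair, hUapply, bitsToNat_encodeNat,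
        ltFn_boolPair]
    rw [hbody, iteFn_apply htest]
    by_cases hle : (bitsToNat (sndPow 1 z) + 2 ^ min (bitsToNat (predCntF z)) (fstF z).length) *
        (bitsToNat (sndPow 1 z) + 2 ^ min (bitsToNat (predCntF z)) (fstF z).length) ≤ bitsToNat (fstF z)
    · rw [if_pos hle, show (!decide (bitsToNat (fstF z) < _)) = true by simpa using hle, if_pos rfl, hUapply]
    · rw [if_neg hle, show (!decide (bitsToNat (fstF z) < _)) = false by simpa using hle]
      simp
  -- growth of the body: at most `|x| + 2` symbols beyond the state
  have hblen : ∀ z, (body z).length ≤ (sndPow 1 z).length + 2 * ((fstF z).length + 1) := by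
    intro z
    have h1 : (encodeNat (bitsToNat (sndPow 1 z))).length ≤ (sndPow 1 z).length := length_encodeNat_bitsToNat_le _
    have h2 : (encodeNat (bitsToNat (sndPow 1 z) + 2 ^ min (bitsToNat (predCntF z)) (fstF z).length)).length ≤
        (sndPow 1 z).length + (fstF z).length + 2 := by
      have h := length_encodeNat_add_le (sndPow 1 z) (encodeNat (2 ^ min (bitsToNat (predCntF z)) (fstF z).length))
      rw [bitsToNat_encodeNat, length_encodeNat_two_pow] at h
      have h3 : min (bitsToNat (predCntF z)) (fstF z).length ≤ (fstF z).length := min_le_right _ _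
      omega
    rw [hbapply]
    split_ifs <;> omega
  -- the loop is in `FP`
  have hloop := loopFn_mem_FP hbodymem hblen (X + C 1)
  -- semantics of the loop model: canonical states, and a square-root scan for counters `≤ |x| + 1`
  have hcanon : ∀ (x : List Bool) (k t : ℕ),
      loopModel body x k (encodeNat t) = encodeNat (bitsToNat (loopModel body x k (encodeNat t))) := by
    intro x k
    induction k with
    | zero => intro t; simp [loopModel]
    | succ k ih =>
      intro t
      have hb : ∃ t', body (boolPair x (boolPair (encodeNat (k + 1)) (encodeNat t))) = encodeNat t' := by
        rw [hbapply]
        split_ifs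
        · exact ⟨_, rfl⟩
        · exact ⟨_, rfl⟩
      obtain ⟨t', ht'⟩ := hb
      simp only [loopModel]
      rw [ht', ih t']
      simp
  have hmodel : ∀ (x : List Bool) (k : ℕ), k ≤ x.length + 1 → ∀ t : ℕ, t * t ≤ bitsToNat x →
      bitsToNat x < (t + 2 ^ k) * (t + 2 ^ k) →
      loopModel body x k (encodeNat t) = encodeNat (Nat.sqrt (bitsToNat x)) := by
    intro x k hk t h1 h2
    rw [hcanon x k t]
    congr 1
    refine sqrtScan_eq_sqrt (N := bitsToNat x) (K := x.length + 1)
      (fun k t => bitsToNat (loopModel body x k (encodeNat t))) (fun t => by simp [loopModel]) ?_ k t hk h1 h2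
    intro k' t' hk'
    have hb : body (boolPair x (boolPair (encodeNat (k' + 1)) (encodeNat t'))) =
        encodeNat (if (t' + 2 ^ k') * (t' + 2 ^ k') ≤ bitsToNat x then t' + 2 ^ k' else t') := by
      rw [hbapply]
      simp only [sndPow_succ_boolPair, sndPow_zero_boolPair, fstF_boolPair, bitsToNat_encodeNat, predCntF_apply,
        Nat.add_sub_cancel, min_eq_left (show k' ≤ x.length by omega)]
      split_ifs <;> rfl
    simp only [loopModel]
    rw [hb]
  -- assembling `natSqrt = sndPow 1 ∘ loop ∘ init`, `init w = ⟨w, ⟨bin (|w| + 1), bin 0⟩⟩`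
  have hinit : (fanoutFn id (fanoutFn (addFn ∘ fanoutFn lenBinF (fun _ => encodeNat 1)) (fun _ => []))) ∈ FP :=
    fanoutFn_mem_FP OracleCompose.id_mem_FP (fanoutFn_mem_FP
      (comp_mem_FP addFn_mem_FP (fanoutFn_mem_FP lenBinF_mem_FP (const_mem_FP _))) (const_mem_FP _))
  have heq : (fun w => encodeNat (Nat.sqrt (bitsToNat w))) =
      sndPow 1 ∘ (fun z => (loopStep body)^[(X + C 1).eval (fstF z).length] z) ∘
        fanoutFn id (fanoutFn (addFn ∘ fanoutFn lenBinF (fun _ => encodeNat 1)) (fun _ => [])) := by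
    funext w
    simp only [Function.comp_apply, fanoutFn_apply, id, lenBinF_apply, addFn_boolPair, bitsToNat_encodeNat,
      fstF_boolPair, eval_add, eval_X, eval_C]
    rw [iterate_loopStep body w (w.length + 1) (w.length + 1) [] le_rfl, sndPow_succ_boolPair, sndPow_zero_boolPair,
      show ([] : List Bool) = encodeNat 0 from rfl, hmodel w (w.length + 1) le_rfl 0 (Nat.zero_le _) ?_]
    rw [zero_add]
    calc bitsToNat w < 2 ^ w.length := bitsToNat_lt w
      _ ≤ 2 ^ (w.length + 1) := Nat.pow_le_pow_right (by norm_num) (Nat.le_succ _)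
      _ ≤ 2 ^ (w.length + 1) * 2 ^ (w.length + 1) := Nat.le_mul_of_pos_right _ (Nat.pow_pos (by norm_num))
  rw [heq]
  exact comp_mem_FP (sndPow_mem_FP 1) (comp_mem_FP hloop hinit)

end Brick

end Literature.Computability.Complexity
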